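import Summits.AtomisticToContinuum.FouriersLaw.Theorems.VanishingNoiseTransferVanishingNoiseBoundUniformLyapunovArith
import Literature.MathematicalPhysics.KineticTheory.LangevinChainTheorem51

/-!
# CEHR Theorem 5.1 for the pinned chain with the energy threshold UNIFORM in the bath
temperatures (helper for stub S2a `stub_uniformAsymmetryTransfer`, line `fekete-usc-one-length`)

`--supports stmt-AtomisticToContinuum-11976` helper file (crux `VanishingNoiseBound`).
`pinnedChain_lintegral_exp_hamiltonian_small` (`LangevinChainTheorem51.lean`:
`E_z e^{θH(z_{t⋆})} ≤ ½ e^{θH(z)}` for `H(z) ≥ E₀`) produces `E₀` EXISTENTIALLY per pair of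
temperatures (`Filter.eventually_atTop` on an explicit decay function whose constants
`C⋆ = θγ(T_L+T_R)`, `κ = θ(1-θT_max)`, `max_b √(2γT_b)`, `p(θT_max)` are monotone in the
temperatures). This file re-runs that proof with the constants frozen at a maximal temperature
`Tmax` (`θ < 1/Tmax`), the per-temperature estimates ((3.4), restart, Chebyshev, Hölder,
Lemma 5.5) being dominated by the frozen ones: `pinnedChain_lintegral_exp_hamiltonian_small_uniform`
gives ONE `E₀` for ALL `0 < T_L, T_R ≤ Tmax`. The closing real inequality is `lyapunov_real_step`
(`…UniformLyapunovArith.lean`). No definitions.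
-/

noncomputable section

open MeasureTheory ProbabilityTheory Filter Topology Set Metric Finset
open scoped NNReal ENNReal Topology BoundedContinuousFunction

namespace Summit.AtomisticToContinuum.FouriersLaw.Theorems.FixedLengthNoiseContinuity

open Literature.MathematicalPhysics.KineticTheory.HeatConduction
open Literature.Probability.Process OscillatorChain

variable {N : ℕ} {ω₂ lam β γ : ℝ}

-- the flow is a limit of Picard iterations: never let the unifier unfold it (heartbeats)
attribute [local irreducible] OscillatorChain.chainFlow

/-- **CEHR Theorem 5.1, qualitative form, with the threshold uniform in the temperatures**
(`ω₂, lam, β, γ > 0`, `N ≥ 2`, `0 < θ < 1/Tmax`, `t⋆ > 0`): there is `E₀` such that for ALL bath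
temperatures `0 < T_L, T_R ≤ Tmax` and every start `z` with `H(z) ≥ E₀`,
`E_z e^{θH(z_{t⋆})} ≤ ½ e^{θH(z)}`. Proof: that of `pinnedChain_lintegral_exp_hamiltonian_small`
(Literature/…/LangevinChainTheorem51.lean) verbatim, with the constants `κ = θ(1-θTmax)`,
`C⋆ = 2θγTmax`, `c_max = √(2γTmax)`, `p = (1 + 1/(θTmax))/2` frozen at `Tmax` and the
per-temperature bounds dominated through `T_L + T_R ≤ 2Tmax`, `max(T_L,T_R) ≤ Tmax`. -/
theorem pinnedChain_lintegral_exp_hamiltonian_small_uniform (hω : 0 < ω₂) (hl : 0 < lam) (hβ : 0 < β)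
    (hγ : 0 < γ) (hN : 1 < N) {θ Tmax : ℝ} (hθ : 0 < θ) (hTmax : 0 < Tmax) (hθ' : θ < 1 / Tmax)
    {tstar : ℝ} (hts : 0 < tstar) :
    ∃ E₀ : ℝ, ∀ T_L T_R : ℝ, 0 < T_L → 0 < T_R → T_L ≤ Tmax → T_R ≤ Tmax →
      ∀ x : PhaseSpace N, E₀ ≤ (pinnedChain ω₂ lam β γ).hamiltonian N x →
      ∫⁻ ω, ENNReal.ofReal (Real.exp (θ * (pinnedChain ω₂ lam β γ).hamiltonian N
          ((pinnedChain ω₂ lam β γ).solMap N T_L T_R tstar x (pairPath ω)))) ∂wienerPair ≤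
        ENNReal.ofReal (Real.exp (θ * (pinnedChain ω₂ lam β γ).hamiltonian N x) / 2) := by
  set P := pinnedChain ω₂ lam β γ with hP
  have hN0 : 0 < N := by omega
  have hθT : θ * Tmax < 1 := (lt_div_iff₀ hTmax).1 hθ'
  -- constants of the estimate, at the maximal temperature `Tmax`
  set κ : ℝ := θ * (1 - θ * Tmax) with hκ
  have hκ0 : 0 < κ := mul_pos hθ (by linarith only [hθT])
  set Cst : ℝ := θ * γ * (Tmax + Tmax) with hCst
  have hCst0 : 0 ≤ Cst := by positivity
  -- the Hölder exponent: `1 < p`, `pθ < 1/T_max`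
  set p : ℝ := (1 + 1 / (θ * Tmax)) / 2 with hp
  have hθT0 : 0 < θ * Tmax := by positivity
  have hp1 : 1 < p := by
    have : 1 < 1 / (θ * Tmax) := by rw [lt_div_iff₀ hθT0]; linarith only [hθT]
    rw [hp]; linarith only [this]
  have hpθ : p * θ < 1 / Tmax := by
    rw [lt_div_iff₀ hTmax, hp]
    calc (1 + 1 / (θ * Tmax)) / 2 * θ * Tmax = (θ * Tmax + 1) / 2 := by field_simp
      _ < 1 := by linarith only [hθT]
  set q := Real.conjExponent p with hq
  have hq0 : 0 < 1 / q := by have := (Real.HolderConjugate.conjExponent hp1).symm.pos; positivity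
  -- the deterministic inputs
  obtain ⟨Λ₀, ε₁, δ₀, a₀, hΛ₀, hε₁, hδ₀, ha₀, hF5⟩ := pinnedChain_dissipation_lower_bound hω hl hβ hγ.le hN0
  obtain ⟨m₀, a₁, hm₀, ha₁, hcell⟩ := pinnedChain_cell_energy_le hω hl.le hβ.le hγ.le N hΛ₀
  set cmax : ℝ := Real.sqrt (2 * γ * Tmax) with hcmax
  have hcmax0 : 0 ≤ cmax := Real.sqrt_nonneg _
  set m₁ : ℝ := m₀ / (cmax + 1) with hm₁
  have hm₁0 : 0 < m₁ := by positivity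
  have hm₁le : cmax * m₁ ≤ m₀ := by
    rw [hm₁, mul_div_assoc', div_le_iff₀ (by positivity)]; nlinarith only [hcmax0, hm₀]
  -- the bound function and its decay
  set Bf : ℝ → ℝ := fun a => Real.exp (Cst * tstar) * Real.exp (-(κ * γ * ε₁ * tstar * a ^ 4)) +
      (tstar / Λ₀ * a + 1) * Real.exp (Cst * tstar) * Real.exp (-(θ / 2 * a ^ 4)) +
      Real.exp (Cst * tstar) * ((tstar / Λ₀ * a + 1) * Real.exp (Cst * tstar) * Real.exp (-(θ / 2 * a ^ 4)) +
        (64 * Λ₀ * tstar / m₁ ^ 4) * (a ^ 5)⁻¹) ^ (1 / q) with hBf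
  have hBf0 : Tendsto Bf atTop (𝓝 0) := by
    have h1 : Tendsto (fun a : ℝ => Real.exp (Cst * tstar) * Real.exp (-(κ * γ * ε₁ * tstar * a ^ 4))) atTop (𝓝 0) := by
      simpa using (tendsto_linear_mul_exp_neg_pow_four (c := 0) le_rfl (k := κ * γ * ε₁ * tstar)
        (by positivity)).const_mul (Real.exp (Cst * tstar))
    have h2 : Tendsto (fun a : ℝ => (tstar / Λ₀ * a + 1) * Real.exp (Cst * tstar) * Real.exp (-(θ / 2 * a ^ 4))) atTop (𝓝 0) := by
      have := (tendsto_linear_mul_exp_neg_pow_four (c := tstar / Λ₀) (by positivity) (k := θ / 2) (by positivity)).const_mul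
        (Real.exp (Cst * tstar))
      rw [mul_zero] at this
      exact this.congr fun a => by ring
    have h3 : Tendsto (fun a : ℝ => (64 * Λ₀ * tstar / m₁ ^ 4) * (a ^ 5)⁻¹) atTop (𝓝 0) :=
      tendsto_const_mul_inv_pow _ (by norm_num)
    have h4 := ((h2.add h3).rpow_const (Or.inr hq0.le)).const_mul (Real.exp (Cst * tstar))
    rw [add_zero, Real.zero_rpow hq0.ne', mul_zero] at h4
    simpa only [add_zero] using (h1.add h2).add h4
  -- thresholds
  have hev : ∀ᶠ a : ℝ in atTop, Bf a < 1 / 2 ∧ max a₀ a₁ ≤ a ∧ 2 * Λ₀ / tstar ≤ a ∧ m₀ / δ₀ ≤ a ∧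
      4 * Λ₀ / m₁ ^ 2 + 1 ≤ a ∧ 1 ≤ a := by
    refine ((tendsto_order.1 hBf0).2 _ (by norm_num)).and ((eventually_ge_atTop _).and
      ((eventually_ge_atTop _).and ((eventually_ge_atTop _).and ((eventually_ge_atTop _).and (eventually_ge_atTop _)))))
  obtain ⟨A, hA⟩ := Filter.eventually_atTop.1 hev
  set A' : ℝ := max A 1 with hA'
  refine ⟨A' ^ 4, fun T_L T_R hTL hTR hTLle hTRle x hx => ?_⟩
  -- the given temperatures against the maximal one
  have hTm : 0 < max T_L T_R := lt_max_of_lt_left hTL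
  have hmaxle : max T_L T_R ≤ Tmax := max_le hTLle hTRle
  have hθ'τ : θ < 1 / max T_L T_R := hθ'.trans_le (one_div_le_one_div_of_le hTm hmaxle)
  have hpθτ : p * θ < 1 / max T_L T_R := hpθ.trans_le (one_div_le_one_div_of_le hTm hmaxle)
  have hCstτ : θ * γ * (T_L + T_R) ≤ Cst := by
    rw [hCst]; exact mul_le_mul_of_nonneg_left (add_le_add hTLle hTRle) (by positivity)
  have hκτ : κ ≤ θ * (1 - θ * max T_L T_R) :=
    hκ ▸ mul_le_mul_of_nonneg_left (sub_le_sub_left (mul_le_mul_of_nonneg_left hmaxle hθ.le) 1) hθ.le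
  have hcmaxτ : max (Real.sqrt (2 * γ * T_L)) (Real.sqrt (2 * γ * T_R)) ≤ cmax :=
    max_le (Real.sqrt_le_sqrt (by nlinarith only [hTLle, hγ]))
      (Real.sqrt_le_sqrt (by nlinarith only [hTRle, hγ]))
  -- Step 1: the scale `a = H(x)^{1/4}` and the grid
  set E : ℝ := P.hamiltonian N x with hE
  have hE0 : 0 ≤ E := le_trans (by positivity) hx
  set a : ℝ := Real.sqrt (Real.sqrt E) with ha
  have ha_nonneg : 0 ≤ a := Real.sqrt_nonneg _
  have ha4 : a ^ 4 = E := by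
    rw [ha, show (4 : ℕ) = 2 * 2 from rfl, pow_mul, Real.sq_sqrt (Real.sqrt_nonneg _), Real.sq_sqrt hE0]
  have haA' : A' ≤ a := by
    have h1 : Real.sqrt (Real.sqrt (A' ^ 4)) = A' := by
      rw [show A' ^ 4 = (A' ^ 2) ^ 2 by ring, Real.sqrt_sq (by positivity), Real.sqrt_sq (by positivity)]
    rw [← h1, ha]; exact Real.sqrt_le_sqrt (Real.sqrt_le_sqrt hx)
  obtain ⟨hBa, hmaxa, hΛa, hmδa, hΛm, ha1⟩ := hA a ((le_max_left _ _).trans haA')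
  have ha0 : 0 < a := by linarith only [ha1]
  have haa₀ : a₀ ≤ a := (le_max_left _ _).trans hmaxa
  have haa₁ : a₁ ≤ a := (le_max_right _ _).trans hmaxa
  -- the grid: `J = ⌊t* a / Λ₀⌋`, `τ = t*/J ∈ [Λ₀/a, 2Λ₀/a]`, `Jτ = t*`
  set r : ℝ := tstar * a / Λ₀ with hr
  have hr2 : 2 ≤ r := by
    rw [hr, le_div_iff₀ hΛ₀]; nlinarith only [(div_le_iff₀ hts).1 hΛa, hts.le]
  set J : ℕ := ⌊r⌋₊ with hJ
  have hJle : (J : ℝ) ≤ r := Nat.floor_le (by linarith only [hr2])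
  have hJlt : r < J + 1 := Nat.lt_floor_add_one r
  have hJ1 : (1 : ℝ) ≤ J := (show (1 : ℝ) < J by linarith only [hr2, hJlt]).le
  have hJpos : (0 : ℝ) < J := by linarith only [hJ1]
  have hJne : (J : ℝ) ≠ 0 := hJpos.ne'
  set τ : ℝ := tstar / J with hτ
  have hτ0 : 0 < τ := div_pos hts hJpos
  have hJτ : (J : ℝ) * τ = tstar := by rw [hτ]; field_simp
  have hτ1 : Λ₀ / a ≤ τ := by
    have : (J : ℝ) * Λ₀ ≤ tstar * a := by
      have := hJle; rw [hr, le_div_iff₀ hΛ₀] at this; linarith only [this]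
    rw [hτ, div_le_div_iff₀ ha0 hJpos]; linarith only [this]
  have hτ2 : τ ≤ 2 * Λ₀ / a := by
    rw [hτ, div_le_div_iff₀ hJpos ha0]
    have : tstar * a ≤ 2 * Λ₀ * J := by
      have h2J : r ≤ 2 * J := by linarith only [hJlt, hJ1]
      rw [hr, div_le_iff₀ hΛ₀] at h2J; linarith only [h2J]
    linarith only [this]
  have hτt : τ ≤ tstar := by rw [hτ, div_le_iff₀ hJpos]; nlinarith only [hJ1, hts.le]
  have hjτ : ∀ j : ℕ, j < J + 1 → (j : ℝ) * τ ≤ tstar := fun j hj => by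
    have : (j : ℝ) ≤ J := by exact_mod_cast Nat.lt_succ_iff.1 hj
    calc (j : ℝ) * τ ≤ J * τ := mul_le_mul_of_nonneg_right this hτ0.le
      _ = tstar := hJτ
  -- small-noise thresholds
  have hnoise2 : m₀ * a ≤ δ₀ * a ^ 2 := by
    nlinarith only [show m₀ ≤ δ₀ * a by rw [div_le_iff₀ hδ₀] at hmδa; linarith only [hmδa], ha0.le]
  have hnoise : cmax * (m₁ * a) ≤ m₀ * a := by rw [← mul_assoc]; exact mul_le_mul_of_nonneg_right hm₁le ha0.le
  have hm'0 : 0 ≤ m₁ * a := by positivity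
  have hτsmall : τ ≤ (m₁ * a) ^ 2 / 2 := by
    refine hτ2.trans ?_
    rw [div_le_div_iff₀ ha0 (by norm_num : (0:ℝ) < 2)]
    have h3 : 4 * Λ₀ / m₁ ^ 2 < a := by linarith only [hΛm]
    rw [div_lt_iff₀ (by positivity)] at h3
    have ha3 : a ≤ a ^ 3 := le_self_pow₀ ha1 (by norm_num)
    nlinarith only [h3, ha3, hΛ₀.le, hm₁0]
  -- Step 2: the events
  set H := P.hamiltonian N with hH
  have hHm : Measurable H := (pinnedChain_continuous_hamiltonian ω₂ lam β γ N).measurable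
  set z : ℕ → WienerPair → PhaseSpace N := fun j ω => P.solMap N T_L T_R (j * τ) x (pairPath ω) with hz
  have hzm : ∀ j, Measurable (z j) := fun j => pinnedChain_measurable_solMap_pairPath_right hω hl.le hβ.le hγ.le N T_L T_R _ x
  set F : WienerPair → ℝ≥0∞ := fun ω => ENNReal.ofReal (Real.exp (θ * H (P.solMap N T_L T_R tstar x (pairPath ω)))) with hF
  have hFm : Measurable F := ENNReal.measurable_ofReal.comp (Real.measurable_exp.comp
    ((hHm.comp (pinnedChain_measurable_solMap_pairPath_right hω hl.le hβ.le hγ.le N T_L T_R tstar x)).const_mul _))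
  set Γ : WienerPair → ℝ := fun ω => P.dissipation N x (P.pairNoise N T_L T_R (pairPath ω)) tstar with hΓ
  have hΓm : Measurable Γ := pinnedChain_measurable_dissipation_pairPath hω hl.le hβ.le hγ.le N tstar x
  set g : ℝ := γ * ε₁ * tstar * E with hg
  set SΓ : Set WienerPair := {ω | g ≤ Γ ω} with hSΓ
  have hSΓm : MeasurableSet SΓ := measurableSet_le measurable_const hΓm
  set D : ℕ → Set WienerPair := fun j => {ω | H (z j ω) < E / 2} with hD
  have hDm : ∀ j, MeasurableSet (D j) := fun j => measurableSet_lt (hHm.comp (hzm j)) measurable_const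
  set U : ℕ → Set WienerPair := fun j => {ω | 3 * E / 2 < H (z j ω)} with hU
  have hUm : ∀ j, MeasurableSet (U j) := fun j => measurableSet_lt measurable_const (hHm.comp (hzm j))
  set Nb : ℕ → Set WienerPair := fun j => {ω | pairShift ((j : ℝ) * τ).toNNReal ω ∉ goodPaths (m₁ * a) τ.toNNReal} with hNb
  have hNbm : ∀ j, MeasurableSet (Nb j) := fun j =>
    ((measurable_pairShift (s := ((j : ℝ) * τ).toNNReal)) (measurableSet_goodPaths (m₁ * a) τ.toNNReal)).compl
  set S₃ : Set WienerPair := (⋃ j ∈ range (J + 1), U j) ∪ (⋃ j ∈ range J, Nb j) with hS₃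
  have hS₃m : MeasurableSet S₃ := (Finset.measurableSet_biUnion _ fun j _ => hUm j).union
    (Finset.measurableSet_biUnion _ fun j _ => hNbm j)
  -- Step 3: off `S₃` and the `D_j`, the dissipation is at least `g` (Cor. 5.4, sure)
  have hcover : ∀ ω, ω ∉ S₃ → (∀ j ∈ range (J + 1), ω ∉ D j) → ω ∈ SΓ := by
    intro ω h3 hD'
    simp only [hS₃, Set.mem_union, Set.mem_iUnion, not_or, not_exists, exists_prop, not_and] at h3
    obtain ⟨hU', hNb'⟩ := h3
    have hgrid : ∀ j : ℕ, j < J → a ^ 4 / 2 ≤ P.hamiltonian N (P.solMap N T_L T_R (j * τ) x (pairPath ω)) ∧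
        P.hamiltonian N (P.solMap N T_L T_R (j * τ) x (pairPath ω)) ≤ 3 * a ^ 4 / 2 := by
      intro j hj
      have hj' : j ∈ range (J + 1) := mem_range.2 (by omega)
      have h1 := hD' j hj'; have h2 := hU' j hj'
      simp only [hD, hU, hz, Set.mem_setOf_eq, not_lt] at h1 h2
      rw [ha4]
      exact ⟨by linarith only [h1], by linarith only [h2]⟩
    have hgood : ∀ j : ℕ, j < J → pairShift ((j : ℝ) * τ).toNNReal ω ∈ goodPaths (m₁ * a) τ.toNNReal := by
      intro j hj
      simpa only [hNb, Set.mem_setOf_eq, not_not] using hNb' j (mem_range.2 hj)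
    have hdis := pinnedChain_grid_dissipation_ge hω hl.le hβ.le hγ.le hN T_L T_R hF5 hcell haa₀ haa₁ hτ0.le hτ1 hτ2
      hm'0 ((mul_le_mul_of_nonneg_right hcmaxτ hm'0).trans hnoise) hnoise2 x J ω hgrid hgood
    rw [hJτ] at hdis
    exact (show g = (J : ℝ) * (γ * (ε₁ * a ^ 4 * τ)) by rw [hg, ← ha4, ← hJτ]; ring).trans_le hdis
  -- pointwise domination of `F`
  have hdom : ∀ ω, F ω ≤ SΓ.indicator F ω + (∑ j ∈ range (J + 1), (D j).indicator F ω) + S₃.indicator F ω := by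
    intro ω
    by_cases h3 : ω ∈ S₃
    · rw [Set.indicator_of_mem h3]; exact le_add_self
    · by_cases hD' : ∃ j ∈ range (J + 1), ω ∈ D j
      · obtain ⟨j, hj, hωj⟩ := hD'
        have : F ω ≤ ∑ j ∈ range (J + 1), (D j).indicator F ω := by
          calc F ω = (D j).indicator F ω := (Set.indicator_of_mem hωj F).symm
            _ ≤ ∑ j ∈ range (J + 1), (D j).indicator F ω :=
                Finset.single_le_sum (f := fun j => (D j).indicator F ω) (fun _ _ => bot_le) hj
        exact this.trans (le_add_left le_rfl |>.trans (le_add_right le_rfl))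
      · push Not at hD'
        rw [Set.indicator_of_mem (hcover ω h3 hD')]
        exact le_add_right (le_add_right le_rfl)
  -- Step 4, (T1) large dissipation: the exponential supermartingale (Lemma 5.5), rate `κ ≤ θ(1-θT_max)`
  have hT1 : ∫⁻ ω, SΓ.indicator F ω ∂wienerPair ≤
      ENNReal.ofReal (Real.exp (-(κ * g)) * Real.exp (θ * E + Cst * tstar)) := by
    have hpt : ∀ ω, SΓ.indicator F ω ≤ ENNReal.ofReal (Real.exp (-(κ * g))) *
        ENNReal.ofReal (Real.exp (θ * H (P.solMap N T_L T_R tstar x (pairPath ω)) + κ * Γ ω)) := by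
      intro ω
      by_cases hω : ω ∈ SΓ
      · rw [Set.indicator_of_mem hω, hF, ← ENNReal.ofReal_mul (Real.exp_pos _).le, ← Real.exp_add]
        refine ENNReal.ofReal_le_ofReal (Real.exp_le_exp.2 ?_)
        have : g ≤ Γ ω := hω
        nlinarith only [this, hκ0]
      · rw [Set.indicator_of_notMem hω]; exact bot_le
    refine (lintegral_mono hpt).trans ?_
    have hm2 : Measurable fun ω => ENNReal.ofReal (Real.exp (θ * H (P.solMap N T_L T_R tstar x (pairPath ω)) + κ * Γ ω)) :=
      ENNReal.measurable_ofReal.comp (Real.measurable_exp.comp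
        (((hHm.comp (pinnedChain_measurable_solMap_pairPath_right hω hl.le hβ.le hγ.le N T_L T_R tstar x)).const_mul _).add
          (hΓm.const_mul _)))
    rw [lintegral_const_mul _ hm2, ENNReal.ofReal_mul (Real.exp_pos _).le]
    gcongr
    have h := pinnedChain_lintegral_exp_hamiltonian_add_dissipation_le hω hl.le hβ.le hγ.le N hTL.le hTR.le hN θ hts.le x
    refine (lintegral_mono fun ω => ENNReal.ofReal_le_ofReal (Real.exp_le_exp.2
      (add_le_add le_rfl (mul_le_mul_of_nonneg_right hκτ ?_)))).trans
      (h.trans (ENNReal.ofReal_le_ofReal (Real.exp_le_exp.2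
        (add_le_add le_rfl (mul_le_mul_of_nonneg_right hCstτ hts.le)))))
    exact pinnedChain_dissipation_nonneg hω hl.le hβ.le hγ.le N x (P.continuous_pairNoise N T_L T_R _) hts.le
  -- (T2) low grid energy: restart and (3.4)
  have hT2 : ∀ j ∈ range (J + 1), ∫⁻ ω, (D j).indicator F ω ∂wienerPair ≤
      ENNReal.ofReal (Real.exp (Cst * tstar) * Real.exp (θ * E / 2)) := by
    intro j hj
    have hj' := mem_range.1 hj
    set B : Set (PhaseSpace N) := {y | H y < E / 2} with hB
    have hBm : MeasurableSet B := measurableSet_lt hHm measurable_const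
    have hind : ∀ ω, (D j).indicator F ω = B.indicator 1 (z j ω) * F ω := fun ω => by
      by_cases hω : ω ∈ D j
      · have : z j ω ∈ B := hω
        rw [Set.indicator_of_mem hω, Set.indicator_of_mem this, Pi.one_apply, one_mul]
      · have : z j ω ∉ B := hω
        rw [Set.indicator_of_notMem hω, Set.indicator_of_notMem this, zero_mul]
    simp_rw [hind]
    have hu : 0 ≤ tstar - j * τ := by linarith only [hjτ j hj']
    have hsj : (((j : ℝ) * τ).toNNReal : ℝ) = j * τ := Real.coe_toNNReal _ (by positivity)
    have hR := pinnedChain_lintegral_indicator_exp_hamiltonian_restart_le hω hl.le hβ.le hγ.le hN0 hTL hTR hθ hθ'τ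
      ((j : ℝ) * τ).toNNReal hu x hBm
    rw [hsj, show (j : ℝ) * τ + (tstar - j * τ) = tstar by ring] at hR
    refine hR.trans ?_
    have hpt : ∀ ω, B.indicator 1 (P.solMap N T_L T_R (j * τ) x (pairPath ω)) *
        ENNReal.ofReal (Real.exp (θ * P.hamiltonian N (P.solMap N T_L T_R (j * τ) x (pairPath ω)))) ≤
        ENNReal.ofReal (Real.exp (θ * E / 2)) := by
      intro ω
      by_cases hω : P.solMap N T_L T_R (j * τ) x (pairPath ω) ∈ B
      · rw [Set.indicator_of_mem hω, Pi.one_apply, one_mul]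
        refine ENNReal.ofReal_le_ofReal (Real.exp_le_exp.2 ?_)
        have : H (P.solMap N T_L T_R (j * τ) x (pairPath ω)) < E / 2 := hω
        nlinarith only [this, hθ]
      · rw [Set.indicator_of_notMem hω, zero_mul]; exact bot_le
    calc ENNReal.ofReal (Real.exp (θ * γ * (T_L + T_R) * (tstar - j * τ))) *
          ∫⁻ ω, B.indicator 1 (P.solMap N T_L T_R (j * τ) x (pairPath ω)) *
            ENNReal.ofReal (Real.exp (θ * P.hamiltonian N (P.solMap N T_L T_R (j * τ) x (pairPath ω)))) ∂wienerPair
        ≤ ENNReal.ofReal (Real.exp (Cst * tstar)) * ∫⁻ _ω, ENNReal.ofReal (Real.exp (θ * E / 2)) ∂wienerPair := by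
          refine mul_le_mul' (ENNReal.ofReal_le_ofReal (Real.exp_le_exp.2 ?_)) (lintegral_mono hpt)
          have : tstar - j * τ ≤ tstar := by linarith only [show (0 : ℝ) ≤ j * τ by positivity]
          exact (mul_le_mul_of_nonneg_left this (by positivity)).trans (mul_le_mul_of_nonneg_right hCstτ hts.le)
      _ = _ := by
          rw [lintegral_const, measure_univ, mul_one, ← ENNReal.ofReal_mul (Real.exp_pos _).le]
  -- (T3) the bad events: Hölder, Chebyshev and the Brownian tail
  have hU_le : ∀ j ∈ range (J + 1), wienerPair (U j) ≤
      ENNReal.ofReal (Real.exp (-(θ * (3 * E / 2))) * (Real.exp (Cst * tstar) * Real.exp (θ * E))) := by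
    intro j hj
    have hj' := mem_range.1 hj
    have h := pinnedChain_measure_lt_hamiltonian_solMap_le hω hl.le hβ.le hγ.le hN0 hTL hTR hθ hθ'τ
      ((j : ℝ) * τ).toNNReal x (3 * E / 2)
    rw [show (((j : ℝ) * τ).toNNReal : ℝ) = j * τ from Real.coe_toNNReal _ (by positivity)] at h
    refine h.trans (ENNReal.ofReal_le_ofReal ?_)
    refine mul_le_mul_of_nonneg_left (mul_le_mul_of_nonneg_right (Real.exp_le_exp.2 ?_) (Real.exp_pos _).le) (Real.exp_pos _).le
    exact (mul_le_mul_of_nonneg_left (hjτ j hj') (by positivity)).trans (mul_le_mul_of_nonneg_right hCstτ hts.le)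
  have hNb_le : ∀ j ∈ range J, wienerPair (Nb j) ≤
      2 * ENNReal.ofReal (2 * τ ^ 2 / ((m₁ * a) ^ 2 - τ) ^ 2) := by
    intro j _
    simp only [hNb]
    rw [measure_pairShift_not_mem_goodPaths ((j : ℝ) * τ).toNNReal (m₁ * a) τ.toNNReal]
    have hτ' : ((τ.toNNReal : ℝ≥0) : ℝ) = τ := Real.coe_toNNReal τ hτ0.le
    have hlt : ((τ.toNNReal : ℝ≥0) : ℝ) < (m₁ * a) ^ 2 := by
      rw [hτ']; linarith only [hτsmall, show 0 < (m₁ * a) ^ 2 by positivity]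
    have := measure_compl_goodEvent_le hm'0 τ.toNNReal hlt
    rwa [hτ'] at this
  set u₁ : ℝ := Real.exp (-(θ * (3 * E / 2))) * (Real.exp (Cst * tstar) * Real.exp (θ * E)) with hu₁
  set u₂ : ℝ := 2 * τ ^ 2 / ((m₁ * a) ^ 2 - τ) ^ 2 with hu₂
  obtain ⟨hu₁0, hu₂0⟩ : 0 ≤ u₁ ∧ 0 ≤ u₂ := ⟨by positivity, by positivity⟩
  set Y : ℝ := (J + 1) * u₁ + J * (2 * u₂) with hY
  have hY0 : 0 ≤ Y := by positivity
  have hJ' : ENNReal.ofReal ((J : ℝ) + 1) = (J : ℝ≥0∞) + 1 := by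
    rw [ENNReal.ofReal_add (Nat.cast_nonneg J) zero_le_one, ENNReal.ofReal_natCast, ENNReal.ofReal_one]
  have hS₃_le : wienerPair S₃ ≤ ENNReal.ofReal Y := by
    calc wienerPair S₃ ≤ wienerPair (⋃ j ∈ range (J + 1), U j) + wienerPair (⋃ j ∈ range J, Nb j) :=
          measure_union_le _ _
      _ ≤ (∑ j ∈ range (J + 1), wienerPair (U j)) + ∑ j ∈ range J, wienerPair (Nb j) :=
          add_le_add (measure_biUnion_finset_le _ _) (measure_biUnion_finset_le _ _)
      _ ≤ (∑ j ∈ range (J + 1), ENNReal.ofReal u₁) + ∑ j ∈ range J, 2 * ENNReal.ofReal u₂ :=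
          add_le_add (Finset.sum_le_sum hU_le) (Finset.sum_le_sum hNb_le)
      _ = ENNReal.ofReal Y := by
          rw [Finset.sum_const, Finset.sum_const, card_range, card_range, nsmul_eq_mul, nsmul_eq_mul, hY,
            ENNReal.ofReal_add (by positivity : 0 ≤ ((J : ℝ) + 1) * u₁) (by positivity : 0 ≤ (J : ℝ) * (2 * u₂)),
            ENNReal.ofReal_mul (by positivity : 0 ≤ (J : ℝ) + 1), ENNReal.ofReal_mul (Nat.cast_nonneg J),
            ENNReal.ofReal_mul (by norm_num : (0 : ℝ) ≤ 2), ENNReal.ofReal_ofNat, ENNReal.ofReal_natCast, hJ']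
          push_cast
          rfl
  have hT3 : ∫⁻ ω, S₃.indicator F ω ∂wienerPair ≤
      ENNReal.ofReal (Real.exp (Cst * tstar) * Real.exp (θ * E)) * ENNReal.ofReal Y ^ (1 / q) := by
    have hind : ∀ ω, S₃.indicator F ω = S₃.indicator 1 ω * F ω := fun ω => by
      by_cases hω : ω ∈ S₃
      · rw [Set.indicator_of_mem hω, Set.indicator_of_mem hω, Pi.one_apply, one_mul]
      · rw [Set.indicator_of_notMem hω, Set.indicator_of_notMem hω, zero_mul]
    simp_rw [hind]
    have h := pinnedChain_lintegral_indicator_exp_hamiltonian_le_rpow hω hl.le hβ.le hγ.le hN0 hTL hTR hθ hp1 hpθτ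
      tstar.toNNReal x hS₃m
    rw [Real.coe_toNNReal tstar hts.le] at h
    refine h.trans ?_
    rw [← hq]
    exact mul_le_mul' (ENNReal.ofReal_le_ofReal (mul_le_mul_of_nonneg_right (Real.exp_le_exp.2
      (mul_le_mul_of_nonneg_right hCstτ hts.le)) (Real.exp_pos _).le)) (ENNReal.rpow_le_rpow hS₃_le hq0.le)
  -- Step 5: assemble
  have hsum : ∫⁻ ω, F ω ∂wienerPair ≤
      ENNReal.ofReal (Real.exp (-(κ * g)) * Real.exp (θ * E + Cst * tstar)) +
      (J + 1) * ENNReal.ofReal (Real.exp (Cst * tstar) * Real.exp (θ * E / 2)) +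
      ENNReal.ofReal (Real.exp (Cst * tstar) * Real.exp (θ * E)) * ENNReal.ofReal Y ^ (1 / q) := by
    have hDsum_m : Measurable fun ω => ∑ j ∈ range (J + 1), (D j).indicator F ω :=
      Finset.measurable_sum _ fun j _ => hFm.indicator (hDm j)
    calc ∫⁻ ω, F ω ∂wienerPair
        ≤ ∫⁻ ω, (SΓ.indicator F ω + (∑ j ∈ range (J + 1), (D j).indicator F ω) + S₃.indicator F ω) ∂wienerPair :=
          lintegral_mono hdom
      _ = (∫⁻ ω, SΓ.indicator F ω ∂wienerPair) + (∑ j ∈ range (J + 1), ∫⁻ ω, (D j).indicator F ω ∂wienerPair) +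
            ∫⁻ ω, S₃.indicator F ω ∂wienerPair := by
          rw [lintegral_add_right _ (hFm.indicator hS₃m), lintegral_add_left (hFm.indicator hSΓm),
            lintegral_finsetSum _ fun j _ => hFm.indicator (hDm j)]
      _ ≤ _ := by
          refine add_le_add (add_le_add hT1 ?_) hT3
          calc ∑ j ∈ range (J + 1), ∫⁻ ω, (D j).indicator F ω ∂wienerPair
              ≤ ∑ j ∈ range (J + 1), ENNReal.ofReal (Real.exp (Cst * tstar) * Real.exp (θ * E / 2)) :=
                Finset.sum_le_sum hT2
            _ = _ := by rw [Finset.sum_const, card_range, nsmul_eq_mul]; push_cast; ring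
  -- everything as one real number
  set X₁ : ℝ := Real.exp (-(κ * g)) * Real.exp (θ * E + Cst * tstar) with hX₁
  set X₂ : ℝ := Real.exp (Cst * tstar) * Real.exp (θ * E / 2) with hX₂
  set X₃ : ℝ := Real.exp (Cst * tstar) * Real.exp (θ * E) with hX₃
  obtain ⟨hX₁0, hX₂0, hX₃0⟩ : 0 ≤ X₁ ∧ 0 ≤ X₂ ∧ 0 ≤ X₃ :=
    ⟨by rw [hX₁]; positivity, by rw [hX₂]; positivity, by rw [hX₃]; positivity⟩
  have hreal : ENNReal.ofReal (X₁ + (J + 1) * X₂ + X₃ * Y ^ (1 / q)) =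
      ENNReal.ofReal X₁ + (J + 1) * ENNReal.ofReal X₂ + ENNReal.ofReal X₃ * ENNReal.ofReal Y ^ (1 / q) := by
    have h1 : 0 ≤ ((J : ℝ) + 1) * X₂ := by positivity
    have h2 : 0 ≤ X₃ * Y ^ (1 / q) := by positivity
    have h3 : 0 ≤ X₁ + ((J : ℝ) + 1) * X₂ := by positivity
    rw [ENNReal.ofReal_add h3 h2, ENNReal.ofReal_add hX₁0 h1, ENNReal.ofReal_mul (by positivity : 0 ≤ (J : ℝ) + 1),
      ENNReal.ofReal_mul hX₃0, ENNReal.ofReal_rpow_of_nonneg hY0 hq0.le, hJ']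
  -- Step 6: the real inequality (`lyapunov_real_step`)
  have hJr : (J : ℝ) ≤ tstar / Λ₀ * a := by rw [div_mul_eq_mul_div]; exact hJle
  have h6 := lyapunov_real_step hq0 hts hΛ₀ hm₁0 ha0 hτ0 hτ2 hτsmall ha4 (Nat.cast_nonneg J) hJr hu₂ hBa
  calc ∫⁻ ω, F ω ∂wienerPair ≤ _ := hsum
    _ = ENNReal.ofReal (X₁ + (J + 1) * X₂ + X₃ * Y ^ (1 / q)) := hreal.symm
    _ ≤ ENNReal.ofReal (Real.exp (θ * E) / 2) := ENNReal.ofReal_le_ofReal h6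

/-- Registered helper sub-goal `helper_uniformLyapunov` of stmt-AtomisticToContinuum-11976
(= `pinnedChain_lintegral_exp_hamiltonian_small_uniform`, fully quantified one-line form). -/
theorem helper_uniformLyapunov : ∀ (ω₂ lam β γ : ℝ), 0 < ω₂ → 0 < lam → 0 < β → 0 < γ → ∀ (N : ℕ), 1 < N → ∀ (θ Tmax : ℝ), 0 < θ → 0 < Tmax → θ < 1 / Tmax → ∀ (tstar : ℝ), 0 < tstar → ∃ E₀ : ℝ, ∀ T_L T_R : ℝ, 0 < T_L → 0 < T_R → T_L ≤ Tmax → T_R ≤ Tmax → ∀ x : Literature.MathematicalPhysics.KineticTheory.HeatConduction.PhaseSpace N, E₀ ≤ (Literature.MathematicalPhysics.KineticTheory.HeatConduction.pinnedChain ω₂ lam β γ).hamiltonian N x → MeasureTheory.lintegral Literature.Probability.Process.wienerPair (fun ω => ENNReal.ofReal (Real.exp (θ * (Literature.MathematicalPhysics.KineticTheory.HeatConduction.pinnedChain ω₂ lam β γ).hamiltonian N ((Literature.MathematicalPhysics.KineticTheory.HeatConduction.pinnedChain ω₂ lam β γ).solMap N T_L T_R tstar x (Literature.Probability.Process.pairPath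 ω))))) ≤ ENNReal.ofReal (Real.exp (θ * (Literature.MathematicalPhysics.KineticTheory.HeatConduction.pinnedChain ω₂ lam β γ).hamiltonian N x) / 2) :=
  fun _ _ _ _ hω hl hβ hγ _ hN _ _ hθ hTmax hθ' _ hts =>
    pinnedChain_lintegral_exp_hamiltonian_small_uniform hω hl hβ hγ hN hθ hTmax hθ' hts

end Summit.AtomisticToContinuum.FouriersLaw.Theorems.FixedLengthNoiseContinuity

end
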